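import Summits.RiemannHypothesis.RiemannHypothesis.Theorems.PfPersistenceDilatingLandauWeightedMellin
import HarnessLib

/-!
# LANDAU for the `n^{-1/2}`-weighted dilating statistic `S(x) = Σ_{n ≤ x} Λ(n)/√n` — II: MV 15.3

Cell `pub-rhpf` (mechanism/rigidity campaign; **no RH claims**), CAND SEAT 7 gen 8, CASE-DAG v6 §6
kernel target LANDAU, weighted statistic, file 2 of 3. With the Mellin data of file 1
(`PfPersistenceDilatingLandauWeightedMellin`):

* `WeightedLandau.false_of_eventually_le` — **MV Theorem 15.3 transported to `S`**: for every zero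
  `ρ₀` of `ζ` with `Re ρ₀ > 1/2`, `η = ±1` and `0 < c < 1/|ρ₀ − 1/2|`, the one-sided bound
  `η (S(x) − 2√x) ≤ c x^{Re ρ₀ − 1/2}` fails for arbitrarily large `x`;
* `WeightedLandau.frequently_le_wpsiErr_and_wpsiErr_le`: `S(x) − 2√x = Ω±(x^{Re ρ₀ − 1/2})`.

Proof: Landau's method exactly as in the tree's `PsiOscillation.false_of_eventually_le`
(MV §15.1), with `ζ₁(s)` replaced by `ζ₁(s + 1/2)` throughout: `A = c x^b − η(S − 2√x) ≥ 0`
(`b = Re ρ₀ − 1/2 > 0`); Landau's lemma continues `F(s) = ∫_1^∞ A x^{-s-1} dx = c/(s − b) +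
η(ζ₁'/ζ₁(s + 1/2) + 2)/s` to `Re s > b`; at `s = ρ₀ − 1/2 + u`, `σ = b + u`, `u ↓ 0`,
`Re(F(σ) + wF(s))` (`w = −η(ρ₀ − 1/2)/|ρ₀ − 1/2|`) is bounded below by positivity and
`≤ (c − m/|ρ₀ − 1/2|)/u + O(1) → −∞`. RH-free, sorry-free. The cell-facing dictionary
(one-sided `O(x^τ)` ⇒ quasi-RH(1/2 + τ), `O(1)` ⇒ RH) is file 3 (`…WeightedDictionary`).

References: [MontgomeryVaughan2007] H. L. Montgomery, R. C. Vaughan, *Multiplicative Number Theory I*,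
CUP 2007, §15.1 (Thm. 15.3 and its proof), Thm. 1.3.
-/

noncomputable section

-- the sub-problem path RiemannHypothesis/RiemannHypothesis duplicates a namespace (D-0017)
set_option linter.dupNamespace false

open Complex Filter Topology Set MeasureTheory Metric Asymptotics

namespace Summit.RiemannHypothesis.RiemannHypothesis.Theorems.PfPersistenceDilatingLandauWeighted

open Literature.NumberTheory.LFunctions
open Literature.NumberTheory.LFunctions.Landau
open Summit.RiemannHypothesis.RiemannHypothesis.Theorems.PfPersistenceDilatingLandauWeightedMellin

namespace WeightedLandau

open PfPersistenceDilatingLandauWeightedMellin.WeightedLandau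

/-! ## §4 MV Theorem 15.3 for `S`: the contradiction from a one-sided bound -/

/-- **The core (MV's proof of Theorem 15.3, shifted by `1/2`).** Let `ρ₀` be a zero of `ζ` with
`Re ρ₀ > 1/2`, `η = ±1`, `0 < c < 1/|ρ₀ − 1/2|`. Then `η (S(x) − 2√x) ≤ c x^{Re ρ₀ − 1/2}` cannot hold
for all large `x`: with `A = c x^b − η(S − 2√x) ≥ 0` (`b = Re ρ₀ − 1/2 > 0`) Landau's lemma continues
`F(s) = ∫_1^∞ A x^{-s-1} dx = c/(s − b) + η(ζ₁'/ζ₁(s+½) + 2)/s` to `Re s > b`; at `s = ρ₀ − 1/2 + u`,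
`σ = b + u`, `u ↓ 0`, `Re(F(σ) + wF(s))` (`w = −η(ρ₀−½)/|ρ₀−½|`) is bounded below by positivity and
`≤ (c − m/|ρ₀ − 1/2|)/u + O(1) → −∞`. [cite: MontgomeryVaughan2007, Thm. 15.3 (proof)] -/
theorem false_of_eventually_le {ρ₀ : ℂ} (h0 : riemannZeta ρ₀ = 0) (hre : 1 / 2 < ρ₀.re) {c η : ℝ}
    (hη : η = 1 ∨ η = -1) (hc0 : 0 < c) (hc : c < 1 / ‖ρ₀ - (1 / 2 : ℝ)‖)
    (hev : ∀ᶠ x in atTop, η * wpsiErr x ≤ c * x ^ (ρ₀.re - 1 / 2)) : False := by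
  -- the zero and its shift `s₀ = ρ₀ − 1/2`
  have hb1 : ρ₀.re < 1 := by
    by_contra h
    exact riemannZeta_ne_zero_of_one_le_re (not_lt.1 h) h0
  have hre0 : 0 < ρ₀.re := by linarith
  have hγ : ρ₀.im ≠ 0 := im_ne_zero_of_riemannZeta_eq_zero h0 hre0 hb1
  have hρ1 : ρ₀ ≠ 1 := by intro h; apply hγ; rw [h]; simp
  have hζ₁0 : riemannZeta₁ ρ₀ = 0 := (riemannZeta₁_eq_zero_iff hρ1).2 h0
  set s₀ : ℂ := ρ₀ - (1 / 2 : ℝ) with hs₀def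
  set b : ℝ := ρ₀.re - 1 / 2 with hbdef
  have hs₀re : s₀.re = b := by simp [hs₀def, hbdef]
  have hs₀im : s₀.im = ρ₀.im := by simp [hs₀def]
  have hγ' : s₀.im ≠ 0 := by rw [hs₀im]; exact hγ
  have hs₀0 : s₀ ≠ 0 := by intro h; apply hγ'; rw [h]; simp
  have hρn : 0 < ‖s₀‖ := norm_pos_iff.2 hs₀0
  have hb0 : 0 < b := by rw [hbdef]; linarith
  have hb2 : b < 1 / 2 := by rw [hbdef]; linarith
  have h12 : ((1 / 2 : ℝ) : ℂ) = 1 / 2 := by norm_num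
  have hshift : ∀ z : ℂ, s₀ + z + 1 / 2 = ρ₀ + z := by
    intro z; rw [hs₀def, h12]; ring
  -- the non-negative function `A`
  obtain ⟨X₁, hX₁⟩ := eventually_atTop.1 hev
  set X₀ : ℝ := max X₁ 1 with hX₀def
  have hX₀ : 1 ≤ X₀ := le_max_right _ _
  set A : ℝ → ℝ := cmpFnW c b η with hAdef
  have hAm : Measurable A := measurable_cmpFnW c b η
  have hpos : ∀ x, X₀ < x → 0 ≤ A x := fun x hx ↦ by
    have := hX₁ x ((le_max_left _ _).trans hx.le)
    simp only [hAdef, cmpFnW]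
    linarith
  have hAbs : ∀ x, 1 < x → |A x| ≤ (c + (Real.log 4 + 6)) * x := fun x hx ↦
    abs_cmpFnW_le hc0.le (by linarith) hη hx
  have hint : IntegrableOn (fun x ↦ A x * x ^ (-((2 : ℝ) + 1))) (Ioi 1) :=
    integrableOn_rpow_of_abs_le_mul_self hAm hAbs (by norm_num)
  -- the zero-free strip `W₀ = {Re s > b, |Im s| < 2δ}` (for `ζ₁(· + 1/2)`)
  obtain ⟨δ, hδ, -, hgap⟩ := ZetaZeroSum.exists_gap_im
  set W₀ : Set ℂ := {s : ℂ | b < s.re ∧ -(2 * δ) < s.im ∧ s.im < 2 * δ} with hW₀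
  have hW₀o : IsOpen W₀ :=
    (isOpen_lt continuous_const Complex.continuous_re).inter
      ((isOpen_lt continuous_const Complex.continuous_im).inter
        (isOpen_lt Complex.continuous_im continuous_const))
  have hW₀c : Convex ℝ W₀ := by
    have : W₀ = {s : ℂ | b < s.re} ∩ ({s : ℂ | -(2 * δ) < s.im} ∩ {s : ℂ | s.im < 2 * δ}) := by
      ext s; simp [hW₀]
    rw [this]
    exact (convex_halfSpace_re_gt _).inter ((convex_halfSpace_im_gt _).inter (convex_halfSpace_im_lt _))
  have hW₀r : ∀ σ' : ℝ, b < σ' → σ' ≤ 2 + 1 → (σ' : ℂ) ∈ W₀ := by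
    intro σ' h1 _
    simp only [hW₀, Set.mem_setOf_eq, Complex.ofReal_re, Complex.ofReal_im]
    exact ⟨h1, by linarith, by linarith⟩
  -- `ζ₁(s + 1/2) ≠ 0` on `{Re s > 2} ∪ W₀`, and `Φ` is holomorphic there
  have hζW : ∀ s ∈ ({s : ℂ | (2 : ℝ) < s.re} ∪ W₀), riemannZeta₁ (s + 1 / 2) ≠ 0 := by
    rintro s (hs | hs)
    · have hs' : (2 : ℝ) < s.re := hs
      have hsh : 1 < (s + 1 / 2).re := by rw [re_add_half]; linarith
      have hs1 : s + 1 / 2 ≠ 1 := by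
        intro h; have := congrArg Complex.re h; rw [one_re] at this; linarith
      rw [Ne, riemannZeta₁_eq_zero_iff hs1]
      exact riemannZeta_ne_zero_of_one_lt_re hsh
    · refine PsiOneExplicit.riemannZeta₁_ne_zero_of_abs_im_lt hgap ?_ ?_
      · rw [im_add_half]
        exact abs_lt.2 ⟨hs.2.1, hs.2.2⟩
      · rw [re_add_half]; linarith [hs.1]
  have hbW : ∀ s ∈ ({s : ℂ | (2 : ℝ) < s.re} ∪ W₀), b < s.re := by
    rintro s (hs | hs)
    · have hs' : (2 : ℝ) < s.re := hs
      linarith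
    · exact hs.1
  have hΦd : DifferentiableOn ℂ (contW c b η) ({s : ℂ | (2 : ℝ) < s.re} ∪ W₀) := by
    intro s hs
    have hbs := hbW s hs
    have hs0 : s ≠ 0 := by intro h; rw [h] at hbs; simp at hbs; linarith
    have hsb : s ≠ (b : ℂ) := by intro h; rw [h] at hbs; simp at hbs
    exact (differentiableAt_contW hsb hs0 (hζW s hs)).differentiableWithinAt
  have hagree : EqOn (contW c b η) (mellinIoi A) {s : ℂ | (2 : ℝ) < s.re} := by
    intro s hs
    have hs' : (2 : ℝ) < s.re := hs
    exact (mellinIoi_cmpFnW (by linarith) (by linarith)).symm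
  -- Landau's lemma: absolute convergence for every `σ > b`
  have hI : ∀ σ : ℝ, b < σ → IntegrableOn (fun x ↦ A x * x ^ (-(σ + 1))) (Ioi 1) := fun σ hσ ↦
    Landau.integrableOn_of_differentiableOn_union_convex hAm hint hX₀ hpos (by linarith : b < 2)
      hW₀o hW₀c hW₀r hΦd hagree hσ
  set F : ℂ → ℂ := mellinIoi A with hFdef
  have hFd : DifferentiableOn ℂ F {s : ℂ | b < s.re} := differentiableOn_mellinIoi_of_forall hAm hI
  -- the identity `s (s-b) Z F = c s Z + η (s-b)(Z' + 2 Z)` on `Re s > b`, `Z(s) = ζ₁(s + 1/2)`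
  set Ψ : ℂ → ℂ := fun s ↦ s * (s - b) * riemannZeta₁ (s + 1 / 2) * F s -
      (c * s * riemannZeta₁ (s + 1 / 2) +
        η * (s - b) * (deriv riemannZeta₁ (s + 1 / 2) + 2 * riemannZeta₁ (s + 1 / 2))) with hΨ
  have hΨd : DifferentiableOn ℂ Ψ {s : ℂ | b < s.re} := by
    intro s hs
    have hF : DifferentiableAt ℂ F s := (hFd s hs).differentiableAt ((isOpen_re_gt b).mem_nhds hs)
    have hsh : DifferentiableAt ℂ (fun z : ℂ ↦ z + 1 / 2) s := differentiableAt_id.add_const _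
    have hz : DifferentiableAt ℂ (fun z : ℂ ↦ riemannZeta₁ (z + 1 / 2)) s :=
      (differentiable_riemannZeta₁ _).comp s hsh
    have hdz0 : DifferentiableAt ℂ (deriv riemannZeta₁) (s + 1 / 2) :=
      (differentiable_riemannZeta₁.analyticAt (s + 1 / 2)).deriv.differentiableAt
    have hdz' : DifferentiableAt ℂ (deriv riemannZeta₁ ∘ fun z : ℂ ↦ z + 1 / 2) s := hdz0.comp s hsh
    have hdz : DifferentiableAt ℂ (fun z : ℂ ↦ deriv riemannZeta₁ (z + 1 / 2)) s := hdz'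
    apply DifferentiableAt.differentiableWithinAt
    have hid : DifferentiableAt ℂ (fun z : ℂ ↦ z) s := differentiableAt_id
    have h1 : DifferentiableAt ℂ (fun z : ℂ ↦ z * (z - b) * riemannZeta₁ (z + 1 / 2) * F z) s :=
      ((hid.mul (hid.sub_const _)).mul hz).mul hF
    have h2 : DifferentiableAt ℂ
        (fun z : ℂ ↦ c * z * riemannZeta₁ (z + 1 / 2) +
          η * (z - b) * (deriv riemannZeta₁ (z + 1 / 2) + 2 * riemannZeta₁ (z + 1 / 2))) s :=
      (((differentiableAt_const _).mul hid).mul hz).add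
        (((differentiableAt_const _).mul (hid.sub_const _)).mul (hdz.add (hz.const_mul _)))
    exact h1.sub h2
  have hΨ0 : EqOn Ψ 0 {s : ℂ | b < s.re} := by
    have hΨa : AnalyticOnNhd ℂ Ψ {s : ℂ | b < s.re} := hΨd.analyticOnNhd (isOpen_re_gt b)
    have h3 : (3 : ℂ) ∈ {s : ℂ | (2 : ℝ) < s.re} := by simp; norm_num
    have hev3 : Ψ =ᶠ[𝓝 (3 : ℂ)] 0 := by
      filter_upwards [(isOpen_re_gt 2).mem_nhds h3] with s hs
      have hs2 : (2 : ℝ) < s.re := hs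
      have hFs : F s = contW c b η s := (hagree hs).symm
      have hζ := hζW s (Or.inl hs)
      have hs0 : s ≠ 0 := by intro h; rw [h] at hs2; simp at hs2; linarith
      have hsb : s - (b : ℂ) ≠ 0 := by
        intro h; have := congrArg Complex.re h; simp at this; linarith
      simp only [hΨ, hFs, contW, kernelW, logDeriv_apply, Pi.zero_apply]
      set Z := riemannZeta₁ (s + 1 / 2) with hZ
      set Z' := deriv riemannZeta₁ (s + 1 / 2) with hZ'
      field_simp
      ring
    have h3' : (3 : ℂ) ∈ {s : ℂ | b < s.re} := by simp; linarith
    exact hΨa.eqOn_zero_of_preconnected_of_eventuallyEq_zero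
      (convex_halfSpace_re_gt b).isPreconnected h3' hev3
  -- local structure at `ρ₀`
  obtain ⟨m, h, r, hm, hr, hha, hh0, hhne, hhd, hfac, hlog⟩ := exists_logDeriv_riemannZeta₁_eq hζ₁0
  have hDc : ContinuousAt (fun z ↦ deriv h z / h z) ρ₀ :=
    hha.deriv.continuousAt.div hha.continuousAt hh0
  set B₀ : ℝ := ‖deriv h ρ₀ / h ρ₀‖ + 1 with hB₀
  have hDev : ∀ᶠ z in 𝓝 ρ₀, ‖deriv h z / h z‖ ≤ B₀ :=
    (hDc.norm.eventually (eventually_lt_nhds (by linarith : ‖deriv h ρ₀ / h ρ₀‖ < B₀))).mono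
      fun z hz ↦ hz.le
  -- the kernel is bounded on the real segment `[b, 3]`
  have hQc : ContinuousOn (fun σ : ℝ ↦ kernelW σ) (Icc b 3) := by
    intro σ hσ
    have hσ0 : 0 < σ := by linarith [hσ.1]
    have hζσ : riemannZeta₁ ((σ : ℂ) + 1 / 2) ≠ 0 := by
      rw [← h12, ← ofReal_add]
      exact riemannZeta₁_ofReal_ne_zero (by linarith)
    have hQσ : ContinuousAt kernelW (σ : ℂ) :=
      (differentiableAt_kernelW (ofReal_ne_zero.2 hσ0.ne') hζσ).continuousAt
    exact (hQσ.comp continuous_ofReal.continuousAt).continuousWithinAt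
  obtain ⟨C₁, hC₁⟩ := isCompact_Icc.exists_bound_of_continuousOn hQc
  -- the head constant `C₀`
  have hloc : IntegrableOn (fun x ↦ |A x| * x ^ (-(b + 1))) (Ioc 1 X₀) := by
    refine Measure.integrableOn_of_bounded measure_Ioc_lt_top.ne
      (((continuous_abs.measurable.comp hAm).mul (measurable_id.pow_const _))).aestronglyMeasurable
      (M := (c + (Real.log 4 + 6)) * X₀) ?_
    rw [ae_restrict_iff' measurableSet_Ioc]
    refine Eventually.of_forall fun x hx ↦ ?_
    have hx0 : 0 < x := zero_lt_one.trans hx.1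
    have hpow : x ^ (-(b + 1)) ≤ 1 := Real.rpow_le_one_of_one_le_of_nonpos hx.1.le (by linarith)
    rw [Real.norm_eq_abs, abs_mul, abs_abs, abs_of_pos (Real.rpow_pos_of_pos hx0 _)]
    calc |A x| * x ^ (-(b + 1)) ≤ (c + (Real.log 4 + 6)) * x * 1 :=
          mul_le_mul (hAbs x hx.1) hpow (Real.rpow_nonneg hx0.le _) (by positivity)
      _ ≤ (c + (Real.log 4 + 6)) * X₀ := by rw [mul_one]; gcongr; exact hx.2
  set C₀ : ℝ := 2 * ∫ x in Ioc 1 X₀, |A x| * x ^ (-(b + 1)) with hC₀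
  -- the total `O(1)` constant and the choice of `u`
  set T : ℝ := C₁ + c / |s₀.im| + m / s₀.im ^ 2 + (B₀ + 1 + 1) / |s₀.im| with hT
  have hgap : 0 < 1 / ‖s₀‖ - c := by linarith
  have htend : Tendsto (fun u : ℝ ↦ ρ₀ + (u : ℂ)) (𝓝[>] 0) (𝓝 ρ₀) := by
    have hc : Continuous (fun u : ℝ ↦ ρ₀ + (u : ℂ)) := continuous_const.add continuous_ofReal
    have h := hc.tendsto 0
    simp only [ofReal_zero, add_zero] at h
    exact h.mono_left nhdsWithin_le_nhds
  have e1 : ∀ᶠ u : ℝ in 𝓝[>] 0, ‖deriv h (ρ₀ + u) / h (ρ₀ + u)‖ ≤ B₀ := htend.eventually hDev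
  have e2 : ∀ᶠ u : ℝ in 𝓝[>] 0, ρ₀ + (u : ℂ) ∈ ball ρ₀ r :=
    htend.eventually (isOpen_ball.mem_nhds (mem_ball_self hr))
  have e3 : ∀ᶠ u : ℝ in 𝓝[>] 0, u < 1 := nhdsWithin_le_nhds (Iio_mem_nhds one_pos)
  have e4 : ∀ᶠ u : ℝ in 𝓝[>] 0, u * (|T| + |C₀| + 1) < 1 / ‖s₀‖ - c := by
    have ht : Tendsto (fun u : ℝ ↦ u * (|T| + |C₀| + 1)) (𝓝 0) (𝓝 0) := by
      have := (tendsto_id (x := 𝓝 (0 : ℝ))).mul_const (|T| + |C₀| + 1)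
      simpa using this
    exact nhdsWithin_le_nhds (ht (Iio_mem_nhds hgap))
  have e0 : ∀ᶠ u : ℝ in 𝓝[>] 0, 0 < u := self_mem_nhdsWithin
  obtain ⟨u, hu0, huB, hur, hu1, huT⟩ := (e0.and (e1.and (e2.and (e3.and e4)))).exists
  -- the two points `s = s₀ + u` and `σ = b + u`
  set s : ℂ := s₀ + u with hsdef
  set σ : ℝ := b + u with hσdef
  set z : ℂ := ρ₀ + u with hzdef
  have hsz : s + 1 / 2 = z := by rw [hsdef, hzdef]; exact hshift u
  have hsre : s.re = σ := by simp [hsdef, hσdef, hs₀re]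
  have hσb : b < σ := by rw [hσdef]; linarith
  have hsH : s ∈ {z : ℂ | b < z.re} := by
    show b < s.re
    rw [hsre]; exact hσb
  have hσH : ((σ : ℝ) : ℂ) ∈ {z : ℂ | b < z.re} := by
    show b < ((σ : ℝ) : ℂ).re
    rw [ofReal_re]; exact hσb
  have hzρ : z ≠ ρ₀ := by
    intro h
    have := congrArg Complex.re h
    simp [hzdef] at this
    linarith
  have hζz : riemannZeta₁ z ≠ 0 := by
    rw [hfac z hur]
    exact mul_ne_zero (pow_ne_zero _ (sub_ne_zero.2 hzρ)) (hhne z hur)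
  have hsim : s.im = s₀.im := by simp [hsdef]
  have hs0 : s ≠ 0 := by intro h; apply hγ'; rw [← hsim, h]; simp
  have hsb0 : s - (b : ℂ) ≠ 0 := by
    intro h; apply hγ'
    have := congrArg Complex.im h
    simpa [hsim] using this
  have hzu : z - ρ₀ = u := by simp [hzdef]
  have huC : (u : ℂ) ≠ 0 := ofReal_ne_zero.2 hu0.ne'
  -- `F(s) = c/(s−b) + η (m/u + (h'/h(z) + 1) + 1)/s`
  have hFs : F s = c / (s - (s₀.re : ℂ)) +
      η * (((m : ℂ) / u + (deriv h z / h z + 1) + 1) / s) := by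
    rw [hs₀re]
    have h1 := hΨ0 hsH
    simp only [hΨ, Pi.zero_apply, sub_eq_zero] at h1
    rw [hsz] at h1
    have h2 := hlog z hur hzρ
    rw [hzu] at h2
    have h3 : F s = (c * s * riemannZeta₁ z + η * (s - b) * (deriv riemannZeta₁ z + 2 * riemannZeta₁ z)) /
        (s * (s - b) * riemannZeta₁ z) := by
      rw [← h1]; field_simp
    have h4 : deriv riemannZeta₁ z = (m / u + deriv h z / h z) * riemannZeta₁ z := by
      rw [← h2]; field_simp
    rw [h3, h4]
    field_simp
    ring
  -- `F(σ) = c/u + η kernelW σ`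
  have hσ0' : 0 < σ := by linarith
  have hζσ : riemannZeta₁ ((σ : ℂ) + 1 / 2) ≠ 0 := by
    rw [← h12, ← ofReal_add]
    exact riemannZeta₁_ofReal_ne_zero (by linarith)
  have hσ0 : ((σ : ℝ) : ℂ) ≠ 0 := ofReal_ne_zero.2 hσ0'.ne'
  have hσbu : ((σ : ℝ) : ℂ) - b = u := by rw [hσdef]; push_cast; ring
  have hFσ : F σ = c / u + η * kernelW σ := by
    unfold kernelW
    rw [logDeriv_apply]
    have h1 := hΨ0 hσH
    simp only [hΨ, Pi.zero_apply, sub_eq_zero] at h1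
    rw [hσbu] at h1
    set Zσ := riemannZeta₁ ((σ : ℂ) + 1 / 2) with hZσ
    set Zσ' := deriv riemannZeta₁ ((σ : ℂ) + 1 / 2) with hZσ'
    have h3 : F σ = (c * σ * Zσ + η * u * (Zσ' + 2 * Zσ)) / (σ * u * Zσ) := by
      rw [← h1]; field_simp
    rw [h3]
    field_simp
  -- the bounds
  have hq : ‖kernelW σ‖ ≤ C₁ := hC₁ σ ⟨hσb.le, by linarith⟩
  have hD : ‖deriv h z / h z + 1‖ ≤ B₀ + 1 := (norm_add_le _ _).trans (by simpa using huB)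
  set w : ℂ := -η * s₀ / (‖s₀‖ : ℂ) with hwdef
  have hηabs : |η| = 1 := by rcases hη with rfl | rfl <;> norm_num
  have hw1 : ‖w‖ ≤ 1 := by
    rw [hwdef, norm_div, norm_mul, norm_neg, Complex.norm_real, Real.norm_eq_abs, hηabs, one_mul,
      Complex.norm_real, Real.norm_eq_abs, abs_of_pos hρn, div_self hρn.ne']
  have hlow := re_mellinIoi_add_mul_ge hAm hX₀ hpos hσb.le (hI σ hσb) hloc hsre hw1
  have hup := re_endgame_le (C₁ := C₁) (q := kernelW σ) (D := deriv h z / h z + 1) hη hu0 hm hc0.le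
    hγ' hsdef hwdef hq hD
  have heq : mellinIoi A σ + w * mellinIoi A s = (c / u : ℂ) + η * kernelW σ +
      w * (c / (s - (s₀.re : ℂ)) + η * (((m : ℂ) / u + (deriv h z / h z + 1) + 1) / s)) := by
    change F σ + w * F s = _
    rw [hFσ, hFs]
  rw [heq] at hlow
  have h1 : -C₀ ≤ (c - 1 / ‖s₀‖) / u + T := hlow.trans hup
  -- contradiction
  have h2 : |T| + |C₀| + 1 < (1 / ‖s₀‖ - c) / u := by
    rw [lt_div_iff₀ hu0]; linarith
  have h3 : (c - 1 / ‖s₀‖) / u = -((1 / ‖s₀‖ - c) / u) := by ring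
  rw [h3] at h1
  linarith [le_abs_self T, le_abs_self C₀]

/-- **MV Theorem 15.3 for `S`, `Ω₊` and `Ω₋` halves.** For every zero `ρ₀` of `ζ` with
`Re ρ₀ > 1/2` and every `0 < c < 1/|ρ₀ − 1/2|`: `S(x) − 2√x ≥ c x^{Re ρ₀ − 1/2}` for arbitrarily
large `x`, and `S(x) − 2√x ≤ −c x^{Re ρ₀ − 1/2}` for arbitrarily large `x`.
[cite: MontgomeryVaughan2007, Thm. 15.3 (shifted to the weight n^{-1/2})] -/
theorem frequently_le_wpsiErr_and_wpsiErr_le {ρ₀ : ℂ} (h0 : riemannZeta ρ₀ = 0)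
    (hre : 1 / 2 < ρ₀.re) {c : ℝ} (hc0 : 0 < c) (hc : c < 1 / ‖ρ₀ - (1 / 2 : ℝ)‖) :
    (∃ᶠ x in atTop, c * x ^ (ρ₀.re - 1 / 2) ≤ wpsiErr x) ∧
      ∃ᶠ x in atTop, wpsiErr x ≤ -(c * x ^ (ρ₀.re - 1 / 2)) := by
  constructor
  · by_contra hnot
    refine false_of_eventually_le h0 hre (η := 1) (Or.inl rfl) hc0 hc ?_
    filter_upwards [not_frequently.1 hnot] with x hx
    rw [one_mul]; exact (not_le.1 hx).le
  · by_contra hnot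
    refine false_of_eventually_le h0 hre (η := -1) (Or.inr rfl) hc0 hc ?_
    filter_upwards [not_frequently.1 hnot] with x hx
    have := (not_le.1 hx).le
    linarith

end WeightedLandau

end Summit.RiemannHypothesis.RiemannHypothesis.Theorems.PfPersistenceDilatingLandauWeighted

end
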